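import Mathlib.Tactic

/-!
# THE CASCADE CERTIFICATE OF THE ONE-SHORT-CIRCUIT CLASS 𝒞(q): THE ARITHMETIC (night-3 g14)
`proofs/NIGHT3-G14-SIZE.md` §5c. In a finite matroid with a 3-circuit `K` such that every set of `≤ q + 2` points not containing `K`
is independent (the class 𝒞(q); `M_q` + generic points of g13 belongs to it for every size, including `n = 2q + 2` where the simple
rule of ThinRow A–E fails), the rank-`q` sets are the `q`-sets with `0 / 1 / 2` points of `K` (types Z / G / 2K) and the `(q+1)`-sets
containing `K` (type a); the rank-`(q+1)` sets are the `(q+1)`-sets with `0 / 1 / 2` points of `K` (free / J / I) and the `(q+2)`-sets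
containing `K` (Q). With `f := n − q − 1 ≥ q` the CASCADE RULE pays by type only:
  a → Q: 1 · · · 2K → I: `s_I`, 2K → Q: `s_Q` · · · G → I: `g_I`, G → J: `g_J` · · · Z → J: `z_J = 2/3`, Z → free: `z_F = 1`,
with `s_Q = min(2/(3(q−1)), 1/f)`, `s_I = 1 + 1/f − s_Q`, `g_I = (q + 1 − (q−1) s_I)/2`, `g_J = (f + 1 − 2 g_I)/(f − 1)`.
This file is the LP behind that rule, kernel-checked: the weights are nonnegative, the demands are met exactly
(2K: `f (s_I + s_Q) = f + 1`; G: `2 g_I + (f−1) g_J = f + 1`; Z: `3 z_J + (f−2) z_F = f`, the last trivial) and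
every set type is within capacity `q + 1` (free: `(q+1) z_F = q + 1`; J: `z_J + q g_J ≤ q + 1`; I:
`2 g_I + (q−1) s_I ≤ q + 1`; Q: `(q−1) + 3(q−1) s_Q ≤ q + 1`) — the nine facts are the conjunction `cascade_weights` (for every
`f ≥ q ≥ 2`, with `s_Q = 2/(3(q−1))`) and `cascade_simple_regime` (`3(q−1) ≤ 2f`, the simple rule `s_Q = 1/f`); the key is
`3q(q−1) ≤ f² + (2q−1) f` for `f ≥ q` (`cascade_key`). The combinatorial half (the type counts of the loaders of each set, paper §5c) is the successor's module; this
file has no matroid in it.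
-/

namespace PercRepro
namespace Cascade

/-- The key inequality of the cascade: `3q(q−1) ≤ f² + (2q−1) f` for `f ≥ q`. -/
theorem cascade_key {q f : ℕ} (hf : q ≤ f) : 3 * q * (q - 1) ≤ f * f + (2 * q - 1) * f := by
  rcases Nat.eq_zero_or_pos q with hq0 | hq1
  · subst hq0; simp
  · obtain ⟨q', rfl⟩ : ∃ q', q = q' + 1 := ⟨q - 1, by omega⟩
    have h1 : q' + 1 - 1 = q' := by omega
    have h2 : 2 * (q' + 1) - 1 = 2 * q' + 1 := by omega
    rw [h1, h2]
    nlinarith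

/-- The weights of the cascade rule in the regime `3(q−1) ≤ 2f` (the simple rule: `s_Q = 1/f`, `s_I = g_I = g_J = 1`). -/
theorem cascade_simple_regime {q f : ℕ} (hq : 2 ≤ q) (hf : q ≤ f) (hreg : 3 * (q - 1) ≤ 2 * f) :
    let sQ : ℚ := 1 / f
    let sI : ℚ := 1 + 1 / f - sQ
    let gI : ℚ := ((q : ℚ) + 1 - ((q : ℚ) - 1) * sI) / 2
    let gJ : ℚ := ((f : ℚ) + 1 - 2 * gI) / ((f : ℚ) - 1)
    0 ≤ sQ ∧ 0 ≤ sI ∧ 0 ≤ gI ∧ 0 ≤ gJ ∧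
      (f : ℚ) * (sI + sQ) = f + 1 ∧ 2 * gI + ((f : ℚ) - 1) * gJ = f + 1 ∧
      (2 : ℚ) / 3 + (q : ℚ) * gJ ≤ q + 1 ∧ 2 * gI + ((q : ℚ) - 1) * sI ≤ q + 1 ∧
      ((q : ℚ) - 1) + 3 * ((q : ℚ) - 1) * sQ ≤ q + 1 := by
  intro sQ sI gI gJ
  have hf0 : (0 : ℚ) < f := by exact_mod_cast (show 0 < f by omega)
  have hf1 : (0 : ℚ) < (f : ℚ) - 1 := by
    have : (2 : ℚ) ≤ f := by exact_mod_cast (show 2 ≤ f by omega)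
    linarith
  have hq1 : (1 : ℚ) ≤ q := by exact_mod_cast (show 1 ≤ q by omega)
  have hsI : sI = 1 := by simp only [sI, sQ]; ring
  have hgI : gI = 1 := by simp only [gI, hsI]; ring
  have hgJ : gJ = 1 := by simp only [gJ, hgI]; field_simp; ring
  have hreg' : 3 * ((q : ℚ) - 1) ≤ 2 * f := by
    have : ((3 * (q - 1) : ℕ) : ℚ) ≤ ((2 * f : ℕ) : ℚ) := by exact_mod_cast hreg
    rw [Nat.cast_mul, Nat.cast_sub (by omega)] at this
    push_cast at this
    linarith
  refine ⟨by positivity, by rw [hsI]; norm_num, by rw [hgI]; norm_num, by rw [hgJ]; norm_num, ?_, ?_, ?_, ?_, ?_⟩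
  · simp only [hsI, sQ]; field_simp
  · rw [hgI, hgJ]; ring
  · rw [hgJ]; linarith
  · rw [hgI, hsI]; ring_nf; exact le_refl _
  · simp only [sQ]
    rw [show ((q : ℚ) - 1) + 3 * ((q : ℚ) - 1) * (1 / f) = ((q : ℚ) - 1) + (3 * ((q : ℚ) - 1)) / f by ring]
    have : (3 * ((q : ℚ) - 1)) / f ≤ 2 := by rw [div_le_iff₀ hf0]; linarith
    linarith

/-- **The cascade weights** `s_Q = 2/(3(q−1))`, `s_I = 1 + 1/f − s_Q`, `g_I = (q + 1 − (q−1) s_I)/2`, `g_J = (f + 1 − 2 g_I)/(f − 1)`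
(with `z_J = 2/3`, `z_F = 1`, `a = 1`) are nonnegative, meet the demands exactly and respect every capacity, for EVERY `f ≥ q ≥ 2` —
in particular below the simple rule's boundary `2f < 3(q−1)`; above it `cascade_simple_regime` is the alternative. -/
theorem cascade_weights {q f : ℕ} (hq : 2 ≤ q) (hf : q ≤ f) :
    let sQ : ℚ := 2 / (3 * ((q : ℚ) - 1))
    let sI : ℚ := 1 + 1 / f - sQ
    let gI : ℚ := ((q : ℚ) + 1 - ((q : ℚ) - 1) * sI) / 2
    let gJ : ℚ := ((f : ℚ) + 1 - 2 * gI) / ((f : ℚ) - 1)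
    0 ≤ sQ ∧ 0 ≤ sI ∧ 0 ≤ gI ∧ 0 ≤ gJ ∧
      (f : ℚ) * (sI + sQ) = f + 1 ∧ 2 * gI + ((f : ℚ) - 1) * gJ = f + 1 ∧
      (2 : ℚ) / 3 + (q : ℚ) * gJ ≤ q + 1 ∧ 2 * gI + ((q : ℚ) - 1) * sI ≤ q + 1 ∧
      ((q : ℚ) - 1) + 3 * ((q : ℚ) - 1) * sQ ≤ q + 1 := by
  intro sQ sI gI gJ
  have hf0 : (0 : ℚ) < f := by exact_mod_cast (show 0 < f by omega)
  have hf1 : (0 : ℚ) < (f : ℚ) - 1 := by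
    have : (2 : ℚ) ≤ f := by exact_mod_cast (show 2 ≤ f by omega)
    linarith
  have hq1 : (0 : ℚ) < (q : ℚ) - 1 := by
    have : (2 : ℚ) ≤ q := by exact_mod_cast hq
    linarith
  have hq0 : (0 : ℚ) < q := by linarith
  have hqf : (q : ℚ) ≤ f := by exact_mod_cast hf
  -- the key inequality, cast to ℚ
  have hkey : 3 * (q : ℚ) * ((q : ℚ) - 1) ≤ (f : ℚ) * f + (2 * (q : ℚ) - 1) * f := by
    have h := cascade_key hf
    have h' : ((3 * q * (q - 1) : ℕ) : ℚ) ≤ ((f * f + (2 * q - 1) * f : ℕ) : ℚ) := by exact_mod_cast h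
    rw [Nat.cast_mul, Nat.cast_mul, Nat.cast_sub (by omega), Nat.cast_add, Nat.cast_mul, Nat.cast_mul,
      Nat.cast_sub (by omega)] at h'
    push_cast at h'
    linarith
  -- closed forms
  have hsQ : sQ = 2 / (3 * ((q : ℚ) - 1)) := rfl
  have hsQ_pos : 0 < sQ := by rw [hsQ]; positivity
  have hq2 : (2 : ℚ) ≤ q := by exact_mod_cast hq
  have hsQ_le : sQ ≤ 2 / 3 := by
    rw [hsQ, div_le_div_iff₀ (by positivity) (by norm_num)]
    linarith
  have hsI_ge : 1 / 3 ≤ sI := by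
    simp only [sI]
    have : (0 : ℚ) ≤ 1 / f := by positivity
    linarith
  have h2gI : 2 * gI = (8 : ℚ) / 3 - ((q : ℚ) - 1) / f := by
    simp only [gI, sI, hsQ]
    field_simp
    ring
  have hgI_nonneg : 0 ≤ gI := by
    have : ((q : ℚ) - 1) / f ≤ 1 := by rw [div_le_one hf0]; linarith
    linarith
  have hgJ_eq : gJ * ((f : ℚ) - 1) = (f : ℚ) + 1 - 2 * gI := by
    simp only [gJ]; field_simp
  have hgJ_nonneg : 0 ≤ gJ := by
    have h1 : (0 : ℚ) ≤ (f : ℚ) + 1 - 2 * gI := by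
      rw [h2gI]
      have : (0 : ℚ) ≤ ((q : ℚ) - 1) / f := div_nonneg hq1.le hf0.le
      have : (2 : ℚ) ≤ f := by exact_mod_cast (show 2 ≤ f by omega)
      linarith
    simp only [gJ]
    exact div_nonneg h1 hf1.le
  refine ⟨hsQ_pos.le, by linarith, hgI_nonneg, hgJ_nonneg, ?_, ?_, ?_, ?_, ?_⟩
  · have e : (1 : ℚ) + 1 / f - sQ + sQ = 1 + 1 / f := by ring
    simp only [sI]
    rw [e]; field_simp
  · have e : ((f : ℚ) - 1) * gJ = gJ * ((f : ℚ) - 1) := by ring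
    rw [e, hgJ_eq]; ring
  · -- (Cap) on J: `q g_J ≤ q + 1/3` ⟺ `g_J ≤ 1 + 1/(3q)` ⟸ the key inequality
    have hgJ_le : gJ ≤ 1 + 1 / (3 * (q : ℚ)) := by
      rw [show gJ = ((f : ℚ) + 1 - 2 * gI) / ((f : ℚ) - 1) from rfl, div_le_iff₀ hf1, h2gI]
      have e1 : (1 + 1 / (3 * (q : ℚ))) * ((f : ℚ) - 1) = (f : ℚ) - 1 + ((f : ℚ) - 1) / (3 * q) := by
        field_simp
      rw [e1]
      -- need: f + 1 − 8/3 + (q−1)/f ≤ f − 1 + (f−1)/(3q)  ⟺  (q−1)/f − 2/3 ≤ (f−1)/(3q)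
      have e2 : ((q : ℚ) - 1) / f ≤ 2 / 3 + ((f : ℚ) - 1) / (3 * q) := by
        rw [div_le_iff₀ hf0]
        have e4 : (2 / 3 + ((f : ℚ) - 1) / (3 * q)) * f = (2 * f * q + f * (f - 1)) / (3 * q) := by
          field_simp
        rw [e4, le_div_iff₀ (by positivity)]
        nlinarith [hkey]
      linarith
    have : (q : ℚ) * gJ ≤ (q : ℚ) * (1 + 1 / (3 * (q : ℚ))) := mul_le_mul_of_nonneg_left hgJ_le hq0.le
    have e3 : (q : ℚ) * (1 + 1 / (3 * (q : ℚ))) = q + 1 / 3 := by field_simp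
    linarith
  · -- (Cap) on I: exact
    have e : 2 * gI + ((q : ℚ) - 1) * sI = q + 1 := by simp only [gI]; ring
    exact le_of_eq e
  · -- (Cap) on Q: exact
    have e : ((q : ℚ) - 1) + 3 * ((q : ℚ) - 1) * sQ = q + 1 := by rw [hsQ]; field_simp; ring
    exact le_of_eq e

end Cascade
end PercRepro
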